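import Literature.Analysis.FluidPDE.KwonSliceMomentum
import Literature.Analysis.FunctionSpaces.DominatedIteratedDeriv
import HarnessLib

/-!
# Kwon's Lemma 2.5: the space–time fields `h, ∇h, f, q` built slice-wise from the velocity

Analysis/FluidPDE file on the discharge path of the named fact
`Literature.Analysis.FluidPDE.kwon2023_velocity_epsilon_regularity`
(`PressureFreeEpsilonRegularity.lean`; H. Kwon, J. Differential Equations (2023) =
arXiv:2104.03160, Thm. 1.4), eleventh brick of Lemma 2.5: the measure-theoretic plumbing that
turns the slice constructions (`KwonHarmonicPart`, `KwonSliceMomentum`) into space–time fields on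
`(−4, 0) × ℝ³`.

* `IsGoodVelocity W`: a jointly strongly measurable field supported in `ℝ × B₂`, in `L³` of
  space–time, **every** slice of which is in `L¹ ∩ L² ∩ L³` with a UNIFORM bound on the spatial
  `L²` norms; `exists_isGoodVelocity`: the zero extension of a velocity `u` with
  `∫∫_{Q₂} |u|³ < ∞` and `A(Q₂) < ∞` (`∫_{B₂}|u(t)|² ≤ A` for a.e. `t`) agrees a.e. with such a
  field (strongly measurable version, cut off to `Q₂`, bad slices — a null set of times,
  Tonelli — replaced by `0`).
* `driftField W t = H(W t)` (Kwon's `h`), `driftGrad W t = ∇H(W t)`, `forceField W t = f_{W t}`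
  (`kwonSliceForce`), `pressureField W P t` = `kwonSlicePressure (W t)` with its Calderón–Zygmund
  piece written through a space–time representative `P` of the Riesz pressures of the weighted
  slices `√φ W(t)` (`pressureField_ae_eq`: equal a.e. in space whenever `P t = Π[√φ W t]` a.e.);
  `exists_rieszRepresentative`: such a `P`, jointly measurable, in `L^{3/2}((−4,0) × ℝ³)`, with
  Stein's slice bound `‖P(t)‖_{3/2} ≤ C_{3/2} ‖W(t)‖₃²` for a.e. `t ∈ (−4,0)` (the tree's
  `exists_spaceTime_rieszPressure_of_memLp` on `(0,4)`, shifted in time).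
* **Joint measurability** of all four fields (`stronglyMeasurable_uncurry_driftField/driftGrad/
  forceField/pressureField`): the potentials are parametric convolutions with continuous
  kernels (`StronglyMeasurable.integral_prod_right'`), and spatial derivatives of jointly
  measurable families of differentiable slices are jointly measurable (the tree's
  `stronglyMeasurable_fderiv_param`, `DominatedIteratedDeriv`); the transposed commutators
  `T'_K` are parametric integrals of `𝔠_K(x,y)ᵀ w(t,x)` (assembled coordinatewise — composing
  with the jointly continuous `uncurry (curlKernel K)` under an applied expected type does not
  elaborate in time); the divergence potential `π[F] = ∫ Γ(· − s) div F(s) ds` with the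
  measurable Newton kernel.
* Uniform bounds `‖h(t,x)‖, ‖∇h(t,x)‖ ≤ C ‖W(t)‖_{L¹(B₂)}` (`exists_norm_driftField/driftGrad_le`,
  from (est.h)).

## Mathlib / tree search

Tree (reused): `harmonicPart`, `contDiff_harmonicPart`, `contDiff_potential_scalar/vector`,
`exists_norm(_fderiv)_harmonicPart_le`, `continuous_gradient_kwonCutoff` (`KwonHarmonicPart`);
`kwonSliceForce`, `kwonSlicePressure`, `integrable_coord_smul` (`KwonSliceMomentum`);
`curlKernel`, `transposeApply`, `curlKernelTranspose`, `continuous_curlKernel`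
(`KwonKernelOperators`); `contDiff_uncurry_commKernelDir/Lap` (`KwonCommutatorFields`);
`selfStretch`, `contDiff_selfStretch`, `kwonFlatCutoff`, `continuous_uncurry_cross`
(`KwonConvectiveTransposes`, `KwonLocalLerayDuality`); `sqrtCutoffSMul`, `czPressure`,
`norm/eLpNorm_sqrtCutoffSMul_le` (`KwonRieszPressurePiece`); `exists_spaceTime_rieszPressure_of_memLp`,
`steinConstThreeHalves` (`RieszPressureSpaceTimeLp`, `RieszPressureL3`); `divPotential_apply`,
`contDiff_divPotential`, `measurable_newtonKernel` (`ClassicalLerayProjection`, `NewtonPotential`);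
`newtonFarSmoothing_apply`, `continuous_newtonFarLaplacian`; `stronglyMeasurable_fderiv_param`
(`FunctionSpaces/DominatedIteratedDeriv`). Mathlib: `StronglyMeasurable.integral_prod_right'`,
`AEStronglyMeasurable.stronglyMeasurable_mk`, `lintegral_prod`, `ae_lt_top'`,
`Measure.ae_ae_of_ae_prod`, `Measure.restrict_prod_eq_prod_univ`, `measurePreserving_add_right`,
`Measure.measurePreserving_sub_left`, `MemLp.comp_measurePreserving`,
`Measure.QuasiMeasurePreserving.ae(_eq_comp)`.

## References

* H. Kwon, J. Differential Equations (2023) = arXiv:2104.03160: Lemma 2.5 and its proof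
  (arXiv p. 8–9), Remark 2.3 (est.h), (est.q). [Kwon2023RolePressure]
-/

noncomputable section

open MeasureTheory Set Function Filter Topology TopologicalSpace Metric InnerProductSpace
  ContinuousLinearMap
open scoped NNReal ENNReal RealInnerProductSpace Convolution Laplacian ContDiff

namespace Literature.Analysis.FluidPDE

namespace Kwon2023

/-! ### A good representative of the velocity on `Q₂` -/

/-- **A good velocity field**: a jointly strongly measurable space–time field, supported in
`ℝ × B₂`, every slice of which lies in `L¹ ∩ L² ∩ L³(ℝ³)`. The velocity `u` of a suitable weak
solution on `Q₂` with `u ∈ L³(Q₂)` agrees a.e. on `Q₂` with such a field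
(`exists_isGoodVelocity`), and Kwon's slice constructions are applied to its slices. [folklore] -/
structure IsGoodVelocity (W : ℝ → EuclideanSpace ℝ (Fin 3) → EuclideanSpace ℝ (Fin 3)) : Prop where
  stronglyMeasurable : StronglyMeasurable (uncurry W)
  integrable : ∀ t, Integrable (W t)
  integrable_sq : ∀ t, Integrable fun x => ‖W t x‖ ^ 2
  memLp_three : ∀ t, MemLp (W t) 3 volume
  eq_zero : ∀ t x, x ∉ ball (0 : EuclideanSpace ℝ (Fin 3)) 2 → W t x = 0
  lintegral_cube_lt_top : ∫⁻ z, ‖uncurry W z‖ₑ ^ (3 : ℕ) < ⊤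
  sq_le_uniform : ∃ A : ℝ, ∀ t, ∫ x, ‖W t x‖ ^ 2 ≤ A

namespace IsGoodVelocity

variable {W : ℝ → EuclideanSpace ℝ (Fin 3) → EuclideanSpace ℝ (Fin 3)}

/-- Slices of a good velocity are strongly measurable. [folklore] -/
theorem stronglyMeasurable_slice (hW : IsGoodVelocity W) (t : ℝ) : StronglyMeasurable (W t) :=
  hW.stronglyMeasurable.comp_measurable measurable_prodMk_left

/-- Slices of a good velocity are a.e. strongly measurable. [folklore] -/
theorem aestronglyMeasurable_slice (hW : IsGoodVelocity W) (t : ℝ) :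
    AEStronglyMeasurable (W t) volume :=
  (hW.stronglyMeasurable_slice t).aestronglyMeasurable

/-- Slices of a good velocity are integrable on `B₂`. [folklore] -/
theorem integrableOn_slice (hW : IsGoodVelocity W) (t : ℝ) :
    IntegrableOn (W t) (ball (0 : EuclideanSpace ℝ (Fin 3)) 2) :=
  (hW.integrable t).integrableOn

end IsGoodVelocity

section Representative

variable {u : ℝ → EuclideanSpace ℝ (Fin 3) → EuclideanSpace ℝ (Fin 3)}

/-- A strongly measurable slice with `∫⁻ ‖w‖ₑ³ < ⊤`, vanishing off `B₂`, lies in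
`L¹ ∩ L² ∩ L³`. [folklore] -/
theorem slice_classes_of_lintegral_lt_top {w : EuclideanSpace ℝ (Fin 3) → EuclideanSpace ℝ (Fin 3)}
    (hw : StronglyMeasurable w) (h3 : ∫⁻ x, ‖w x‖ₑ ^ (3 : ℕ) < ⊤)
    (h0 : ∀ x, x ∉ ball (0 : EuclideanSpace ℝ (Fin 3)) 2 → w x = 0) :
    Integrable w ∧ Integrable (fun x => ‖w x‖ ^ 2) ∧ MemLp w 3 volume := by
  have hmem3 : MemLp w 3 volume := by
    refine ⟨hw.aestronglyMeasurable, ?_⟩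
    rw [eLpNorm_lt_top_iff_lintegral_rpow_enorm_lt_top (by norm_num) (by norm_num)]
    simpa [ENNReal.toReal_ofNat] using h3
  -- `w = 1_{B₂} w`, and `B₂` has finite measure
  have hind : w = (ball (0 : EuclideanSpace ℝ (Fin 3)) 2).indicator w := by
    funext x
    by_cases hx : x ∈ ball (0 : EuclideanSpace ℝ (Fin 3)) 2
    · rw [indicator_of_mem hx]
    · rw [indicator_of_notMem hx, h0 x hx]
  have hfin : volume (ball (0 : EuclideanSpace ℝ (Fin 3)) 2) < ⊤ := measure_ball_lt_top
  have hmem3' : MemLp w 3 (volume.restrict (ball (0 : EuclideanSpace ℝ (Fin 3)) 2)) := hmem3.restrict _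
  haveI : IsFiniteMeasure (volume.restrict (ball (0 : EuclideanSpace ℝ (Fin 3)) 2)) :=
    ⟨by simpa using hfin⟩
  have hmem2' : MemLp w 2 (volume.restrict (ball (0 : EuclideanSpace ℝ (Fin 3)) 2)) :=
    hmem3'.mono_exponent (by norm_num)
  have hmem1' : MemLp w 1 (volume.restrict (ball (0 : EuclideanSpace ℝ (Fin 3)) 2)) :=
    hmem3'.mono_exponent (by norm_num)
  have hint : Integrable w := by
    rw [hind, integrable_indicator_iff measurableSet_ball]
    exact memLp_one_iff_integrable.1 hmem1'
  have hint2 : Integrable fun x => ‖w x‖ ^ 2 := by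
    have h := hmem2'.integrable_norm_pow (by norm_num)
    have hind2 : (fun x => ‖w x‖ ^ 2) = (ball (0 : EuclideanSpace ℝ (Fin 3)) 2).indicator
        fun x => ‖w x‖ ^ 2 := by
      funext x
      by_cases hx : x ∈ ball (0 : EuclideanSpace ℝ (Fin 3)) 2
      · rw [indicator_of_mem hx]
      · rw [indicator_of_notMem hx, h0 x hx, norm_zero, zero_pow two_ne_zero]
    rw [hind2, integrable_indicator_iff measurableSet_ball]
    exact h
  exact ⟨hint, hint2, hmem3⟩

/-- **Existence of a good representative.** If `u` is a.e. strongly measurable on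
`Q₂ = (−4,0) × B₂` with `∫∫_{Q₂} |u|³ < ⊤` and essentially bounded spatial `L²(B₂)` norms
(`∫_{B₂} |u(t)|² ≤ A` for a.e. `t ∈ (−4,0)`, i.e. `A(Q₂) < ∞`), then the zero extension of `u` off
`Q₂` agrees a.e. on `ℝ × ℝ³` with a good velocity field (a strongly measurable version, cut off to
`Q₂`, with the null set of bad time slices replaced by `0`; Tonelli). [folklore] -/
theorem exists_isGoodVelocity
    (hum : AEStronglyMeasurable (uncurry u) (volume.restrict (parabolicCylinder 2 (0 : ℝ × EuclideanSpace ℝ (Fin 3)))))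
    (hu3 : ∫⁻ z in parabolicCylinder 2 (0 : ℝ × EuclideanSpace ℝ (Fin 3)), ‖uncurry u z‖ₑ ^ (3 : ℕ) < ⊤)
    {A : ℝ≥0∞} (hAtop : A < ⊤)
    (hA : ∀ᵐ t : ℝ, t ∈ Ioo (-4 : ℝ) 0 →
      ∫⁻ x in ball (0 : EuclideanSpace ℝ (Fin 3)) 2, ‖u t x‖ₑ ^ (2 : ℕ) ≤ A) :
    ∃ W, IsGoodVelocity W ∧
      uncurry W =ᵐ[volume] (parabolicCylinder 2 (0 : ℝ × EuclideanSpace ℝ (Fin 3))).indicator (uncurry u) := by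
  set Q : Set (ℝ × EuclideanSpace ℝ (Fin 3)) := parabolicCylinder 2 0 with hQ
  have hQm : MeasurableSet Q := (isOpen_parabolicCylinder 2 _).measurableSet
  have hQeq : Q = Ioo (-4 : ℝ) 0 ×ˢ ball (0 : EuclideanSpace ℝ (Fin 3)) 2 := by
    rw [hQ, parabolicCylinder]; norm_num
  -- the zero extension and a strongly measurable version, cut off to `Q`
  set U₀ : ℝ × EuclideanSpace ℝ (Fin 3) → EuclideanSpace ℝ (Fin 3) := Q.indicator (uncurry u) with hU₀
  have hU₀m : AEStronglyMeasurable U₀ volume := by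
    rw [hU₀, aestronglyMeasurable_indicator_iff hQm]; exact hum
  set W₁ : ℝ × EuclideanSpace ℝ (Fin 3) → EuclideanSpace ℝ (Fin 3) := Q.indicator hU₀m.mk with hW₁
  have hW₁m : StronglyMeasurable W₁ := hU₀m.stronglyMeasurable_mk.indicator hQm
  have hW₁eq : W₁ =ᵐ[volume] U₀ := by
    have h := hU₀m.ae_eq_mk
    filter_upwards [h] with z hz
    rw [hW₁]
    by_cases hzQ : z ∈ Q
    · rw [indicator_of_mem hzQ, ← hz]
    · rw [indicator_of_notMem hzQ, hU₀, indicator_of_notMem hzQ]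
  have hW₁zero : ∀ t x, x ∉ ball (0 : EuclideanSpace ℝ (Fin 3)) 2 → W₁ (t, x) = 0 := by
    intro t x hx
    rw [hW₁, indicator_of_notMem]
    rw [hQeq]; exact fun h => hx h.2
  -- `∫∫ |W₁|³ < ⊤`, hence a.e. slice has `∫ |W₁(t)|³ < ⊤`
  have h3 : ∫⁻ z, ‖W₁ z‖ₑ ^ (3 : ℕ) < ⊤ := by
    have e1 : ∫⁻ z, ‖W₁ z‖ₑ ^ (3 : ℕ) = ∫⁻ z, ‖U₀ z‖ₑ ^ (3 : ℕ) :=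
      lintegral_congr_ae (hW₁eq.mono fun z hz => by dsimp only; rw [hz])
    have e2 : (fun z => ‖U₀ z‖ₑ ^ (3 : ℕ)) = Q.indicator fun z => ‖uncurry u z‖ₑ ^ (3 : ℕ) := by
      funext z
      by_cases hz : z ∈ Q
      · rw [indicator_of_mem hz, hU₀, indicator_of_mem hz]
      · rw [indicator_of_notMem hz, hU₀, indicator_of_notMem hz]; simp
    rw [e1, e2, lintegral_indicator hQm]
    exact hu3
  have hslice3 : ∀ᵐ t : ℝ, ∫⁻ x, ‖W₁ (t, x)‖ₑ ^ (3 : ℕ) < ⊤ := by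
    have hmeas : Measurable fun z : ℝ × EuclideanSpace ℝ (Fin 3) => ‖W₁ z‖ₑ ^ (3 : ℕ) :=
      hW₁m.measurable.enorm.pow_const _
    have hprod : ∫⁻ t, ∫⁻ x, ‖W₁ (t, x)‖ₑ ^ (3 : ℕ) < ⊤ := by
      rw [← lintegral_prod _ hmeas.aemeasurable]
      simpa [Measure.volume_eq_prod] using h3
    exact ae_lt_top' (hmeas.lintegral_prod_right'.aemeasurable) hprod.ne
  -- a.e. slice has `∫ |W₁(t)|² ≤ A`
  have hslice2 : ∀ᵐ t : ℝ, ∫⁻ x, ‖W₁ (t, x)‖ₑ ^ (2 : ℕ) ≤ A := by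
    have h' : ∀ᵐ t : ℝ, ∀ᵐ x : EuclideanSpace ℝ (Fin 3), W₁ (t, x) = U₀ (t, x) :=
      Measure.ae_ae_of_ae_prod (p := fun z => W₁ z = U₀ z) (by rw [← Measure.volume_eq_prod]; exact hW₁eq)
    filter_upwards [h', hA] with t ht htA
    rw [lintegral_congr_ae (ht.mono fun x hx => show ‖W₁ (t, x)‖ₑ ^ (2 : ℕ) = ‖U₀ (t, x)‖ₑ ^ (2 : ℕ) by
      rw [hx])]
    by_cases htI : t ∈ Ioo (-4 : ℝ) 0
    · have e : (fun x => ‖U₀ (t, x)‖ₑ ^ (2 : ℕ)) = (ball (0 : EuclideanSpace ℝ (Fin 3)) 2).indicator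
          fun x => ‖u t x‖ₑ ^ (2 : ℕ) := by
        funext x
        rw [hU₀, hQeq]
        by_cases hx : x ∈ ball (0 : EuclideanSpace ℝ (Fin 3)) 2
        · rw [indicator_of_mem (mk_mem_prod htI hx), indicator_of_mem hx]; rfl
        · rw [indicator_of_notMem (fun h => hx h.2), indicator_of_notMem hx]; simp
      rw [e, lintegral_indicator measurableSet_ball]; exact htA htI
    · have e : (fun x => ‖U₀ (t, x)‖ₑ ^ (2 : ℕ)) = fun _ => 0 := by
        funext x; rw [hU₀, hQeq, indicator_of_notMem (fun h => htI h.1)]; simp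
      rw [e, lintegral_zero]; exact zero_le
  -- the good time set
  have hmeas3 : Measurable fun z : ℝ × EuclideanSpace ℝ (Fin 3) => ‖W₁ z‖ₑ ^ (3 : ℕ) :=
    hW₁m.measurable.enorm.pow_const _
  have hmeas2 : Measurable fun z : ℝ × EuclideanSpace ℝ (Fin 3) => ‖W₁ z‖ₑ ^ (2 : ℕ) :=
    hW₁m.measurable.enorm.pow_const _
  set S : Set ℝ := {t | ∫⁻ x, ‖W₁ (t, x)‖ₑ ^ (3 : ℕ) < ⊤ ∧ ∫⁻ x, ‖W₁ (t, x)‖ₑ ^ (2 : ℕ) ≤ A} with hS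
  have hSm : MeasurableSet S := (measurableSet_lt hmeas3.lintegral_prod_right' measurable_const).inter
    (measurableSet_le hmeas2.lintegral_prod_right' measurable_const)
  have hSae : ∀ᵐ t : ℝ, t ∈ S := hslice3.and hslice2
  have hSc : volume Sᶜ = 0 := by simpa [mem_ae_iff] using hSae
  classical
  -- the representative
  set W : ℝ → EuclideanSpace ℝ (Fin 3) → EuclideanSpace ℝ (Fin 3) :=
    fun t x => if t ∈ S then W₁ (t, x) else 0 with hW
  have hWunc : uncurry W = (S ×ˢ (univ : Set (EuclideanSpace ℝ (Fin 3)))).indicator W₁ := by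
    funext z
    obtain ⟨t, x⟩ := z
    by_cases ht : t ∈ S
    · rw [indicator_of_mem (mk_mem_prod ht (mem_univ _))]; simp [hW, ht]
    · rw [indicator_of_notMem (fun h => ht h.1)]; simp [hW, ht]
  have hslices : ∀ t, StronglyMeasurable fun x => W₁ (t, x) := fun t =>
    hW₁m.comp_measurable measurable_prodMk_left
  -- `W = W₁` off the null set `Sᶜ × ℝ³`, and `W₁ = U₀` a.e.
  have hnull : volume ((S ×ˢ (univ : Set (EuclideanSpace ℝ (Fin 3))))ᶜ) = 0 := by
    rw [show (S ×ˢ (univ : Set (EuclideanSpace ℝ (Fin 3))))ᶜ = Sᶜ ×ˢ univ by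
      ext z; simp [mem_prod], Measure.volume_eq_prod, Measure.prod_prod, hSc, zero_mul]
  have hWW₁ : uncurry W =ᵐ[volume] W₁ := by
    rw [hWunc, Filter.EventuallyEq, ae_iff]
    refine measure_mono_null (fun z hz => ?_) hnull
    intro hzS
    exact hz (indicator_of_mem hzS _)
  refine ⟨W, ⟨?_, fun t => ?_, fun t => ?_, fun t => ?_, fun t x hx => ?_, ?_, ⟨A.toReal, fun t => ?_⟩⟩,
    hWW₁.trans hW₁eq⟩
  · rw [hWunc]; exact hW₁m.indicator (hSm.prod MeasurableSet.univ)
  · by_cases ht : t ∈ S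
    · have e : W t = fun x => W₁ (t, x) := by funext x; simp [hW, ht]
      rw [e]; exact (slice_classes_of_lintegral_lt_top (hslices t) ht.1 (hW₁zero t)).1
    · have e : W t = fun _ => 0 := by funext x; simp [hW, ht]
      rw [e]; exact integrable_zero _ _ _
  · by_cases ht : t ∈ S
    · have e : W t = fun x => W₁ (t, x) := by funext x; simp [hW, ht]
      rw [e]; exact (slice_classes_of_lintegral_lt_top (hslices t) ht.1 (hW₁zero t)).2.1
    · have e : W t = fun _ => 0 := by funext x; simp [hW, ht]
      rw [e]; simp
  · by_cases ht : t ∈ S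
    · have e : W t = fun x => W₁ (t, x) := by funext x; simp [hW, ht]
      rw [e]; exact (slice_classes_of_lintegral_lt_top (hslices t) ht.1 (hW₁zero t)).2.2
    · have e : W t = fun _ => 0 := by funext x; simp [hW, ht]
      rw [e]; exact MemLp.zero'
  · by_cases ht : t ∈ S
    · simp only [hW, ht, if_true]; exact hW₁zero t x hx
    · simp [hW, ht]
  · have e : ∫⁻ z, ‖uncurry W z‖ₑ ^ (3 : ℕ) = ∫⁻ z, ‖W₁ z‖ₑ ^ (3 : ℕ) :=
      lintegral_congr_ae (hWW₁.mono fun z hz => by simp only [hz])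
    rw [e]; exact h3
  · by_cases ht : t ∈ S
    · have e : W t = fun x => W₁ (t, x) := by funext x; simp [hW, ht]
      have hcl := slice_classes_of_lintegral_lt_top (hslices t) ht.1 (hW₁zero t)
      rw [e, integral_eq_lintegral_of_nonneg_ae (Eventually.of_forall fun x => by positivity)
        (hcl.2.1.aestronglyMeasurable)]
      refine ENNReal.toReal_mono hAtop.ne ?_
      refine le_trans (le_of_eq (lintegral_congr_ae (Eventually.of_forall fun x => ?_))) ht.2
      dsimp only
      rw [ENNReal.ofReal_pow (norm_nonneg _), ofReal_norm]
    · have e : W t = fun _ => 0 := by funext x; simp [hW, ht]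
      rw [e]; simp

end Representative

/-! ### Parametric convolution potentials are jointly measurable -/

section ParamMeasurable

open Literature.Analysis.FunctionSpaces

variable {W : ℝ → EuclideanSpace ℝ (Fin 3) → EuclideanSpace ℝ (Fin 3)}

/-- A scalar parametric convolution `(t, x) ↦ ∫ k(s) d(t, x − s) ds` with a continuous kernel and a
jointly strongly measurable density is jointly strongly measurable. [folklore] -/
theorem stronglyMeasurable_uncurry_convolution_scalar {k : EuclideanSpace ℝ (Fin 3) → ℝ}
    (hk : Continuous k) {d : ℝ → EuclideanSpace ℝ (Fin 3) → ℝ} (hd : StronglyMeasurable (uncurry d)) :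
    StronglyMeasurable (uncurry fun t x => ∫ s, k s * d t (x - s)) := by
  have h : StronglyMeasurable fun q : (ℝ × EuclideanSpace ℝ (Fin 3)) × EuclideanSpace ℝ (Fin 3) =>
      k q.2 * d q.1.1 (q.1.2 - q.2) :=
    (hk.comp continuous_snd).stronglyMeasurable.mul
      (hd.comp_measurable ((measurable_fst.comp measurable_fst).prodMk
        ((measurable_snd.comp measurable_fst).sub measurable_snd)))
  exact h.integral_prod_right'

/-- A vector parametric convolution `(t, x) ↦ ∫ k(s) • d(t, x − s) ds` with a continuous kernel and
a jointly strongly measurable density is jointly strongly measurable. [folklore] -/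
theorem stronglyMeasurable_uncurry_convolution_vector {k : EuclideanSpace ℝ (Fin 3) → ℝ}
    (hk : Continuous k) {d : ℝ → EuclideanSpace ℝ (Fin 3) → EuclideanSpace ℝ (Fin 3)}
    (hd : StronglyMeasurable (uncurry d)) :
    StronglyMeasurable (uncurry fun t x => ∫ s, k s • d t (x - s)) := by
  have h : StronglyMeasurable fun q : (ℝ × EuclideanSpace ℝ (Fin 3)) × EuclideanSpace ℝ (Fin 3) =>
      k q.2 • d q.1.1 (q.1.2 - q.2) :=
    (hk.comp continuous_snd).stronglyMeasurable.smul
      (hd.comp_measurable ((measurable_fst.comp measurable_fst).prodMk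
        ((measurable_snd.comp measurable_fst).sub measurable_snd)))
  exact h.integral_prod_right'

/-- The scalar densities `(t, y) ↦ W(t,y)·∇φ(y)` of a jointly measurable field are jointly
measurable. [folklore] -/
theorem stronglyMeasurable_uncurry_scalarDensity (hW : StronglyMeasurable (uncurry W)) :
    StronglyMeasurable (uncurry fun t y => scalarDensity (W t) y) :=
  hW.inner (continuous_gradient_kwonCutoff.comp continuous_snd).stronglyMeasurable

/-- The vector densities `(t, y) ↦ ∇φ(y) × W(t,y)` are jointly measurable. [folklore] -/
theorem stronglyMeasurable_uncurry_vectorDensity (hW : StronglyMeasurable (uncurry W)) :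
    StronglyMeasurable (uncurry fun t y => vectorDensity (W t) y) := by
  have e : uncurry (fun t y => vectorDensity (W t) y) =
      fun p : ℝ × EuclideanSpace ℝ (Fin 3) => uncurry cross (gradient kwonCutoff p.2, uncurry W p) := by
    funext p; rfl
  rw [e]
  exact continuous_uncurry_cross.comp_stronglyMeasurable
    ((continuous_gradient_kwonCutoff.comp continuous_snd).stronglyMeasurable.prodMk hW)

end ParamMeasurable

/-! ### The drift `h` and its gradient -/

section Drift

open Literature.Analysis.FunctionSpaces

variable {W : ℝ → EuclideanSpace ℝ (Fin 3) → EuclideanSpace ℝ (Fin 3)}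

variable (W) in
/-- **Kwon's drift** `h(t, ·) = H(W(t))`, the harmonic part of the slices. [cite: Kwon2023RolePressure, Lemma 2.5] -/
def driftField (t : ℝ) (x : EuclideanSpace ℝ (Fin 3)) : EuclideanSpace ℝ (Fin 3) := harmonicPart (W t) x

variable (W) in
/-- The spatial gradient `∇h(t, ·)` of the drift. [cite: Kwon2023RolePressure, Lemma 2.5] -/
def driftGrad (t : ℝ) (x : EuclideanSpace ℝ (Fin 3)) :
    EuclideanSpace ℝ (Fin 3) →L[ℝ] EuclideanSpace ℝ (Fin 3) :=
  fderiv ℝ (harmonicPart (W t)) x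

/-- The slices of the drift are smooth. [folklore] -/
theorem contDiff_driftField (hW : IsGoodVelocity W) (t : ℝ) {n : ℕ∞} : ContDiff ℝ n (driftField W t) :=
  contDiff_harmonicPart (integrable_scalarDensity (hW.integrableOn_slice t)).locallyIntegrable
    (integrable_vectorDensity (hW.integrableOn_slice t)).locallyIntegrable

/-- **The drift is jointly measurable** (its potentials are parametric convolutions with the
continuous annular kernel; their spatial derivatives are jointly measurable by the tree's
`stronglyMeasurable_fderiv_param`). [folklore] -/
theorem stronglyMeasurable_uncurry_driftField (hW : IsGoodVelocity W) :
    StronglyMeasurable (uncurry (driftField W)) := by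
  -- the two potentials as parametric integrals
  set Φ₁ : ℝ → EuclideanSpace ℝ (Fin 3) → ℝ := fun t => annularKernel ⋆ scalarDensity (W t) with hΦ₁
  set Φ₂ : ℝ → EuclideanSpace ℝ (Fin 3) → EuclideanSpace ℝ (Fin 3) :=
    fun t => annularKernel ⋆[lsmul ℝ ℝ, volume] vectorDensity (W t) with hΦ₂
  have e₁ : Φ₁ = fun t x => ∫ s, annularKernel s * scalarDensity (W t) (x - s) := by
    funext t x; rw [hΦ₁]; dsimp only; rw [convolution_lsmul]; rfl
  have e₂ : Φ₂ = fun t x => ∫ s, annularKernel s • vectorDensity (W t) (x - s) := by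
    funext t x; rw [hΦ₂]; dsimp only; rw [convolution_lsmul]
  have hk : Continuous annularKernel := (contDiff_annularKernel (n := 0)).continuous
  have hΦ₁m : StronglyMeasurable (uncurry Φ₁) := by
    rw [e₁]; exact stronglyMeasurable_uncurry_convolution_scalar hk
      (stronglyMeasurable_uncurry_scalarDensity hW.stronglyMeasurable)
  have hΦ₂m : StronglyMeasurable (uncurry Φ₂) := by
    rw [e₂]; exact stronglyMeasurable_uncurry_convolution_vector hk
      (stronglyMeasurable_uncurry_vectorDensity hW.stronglyMeasurable)
  have hΦ₁d : ∀ t x, DifferentiableAt ℝ (Φ₁ t) x := fun t x =>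
    ((contDiff_potential_scalar (n := 1) (integrable_scalarDensity
      (hW.integrableOn_slice t)).locallyIntegrable).differentiable one_ne_zero) x
  have hΦ₂d : ∀ t x, DifferentiableAt ℝ (Φ₂ t) x := fun t x =>
    ((contDiff_potential_vector (n := 1) (integrable_vectorDensity
      (hW.integrableOn_slice t)).locallyIntegrable).differentiable one_ne_zero) x
  have hD₁ := stronglyMeasurable_fderiv_param hΦ₁m hΦ₁d
  have hD₂ := stronglyMeasurable_fderiv_param hΦ₂m hΦ₂d
  have e : uncurry (driftField W) = fun q : ℝ × EuclideanSpace ℝ (Fin 3) =>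
      (InnerProductSpace.toDual ℝ (EuclideanSpace ℝ (Fin 3))).symm (fderiv ℝ (Φ₁ q.1) q.2)
        - curlCLM (fderiv ℝ (Φ₂ q.1) q.2) := by
    funext q; rfl
  rw [e]
  exact ((InnerProductSpace.toDual ℝ (EuclideanSpace ℝ (Fin 3))).symm.continuous.comp_stronglyMeasurable
    hD₁).sub (curlCLM.continuous.comp_stronglyMeasurable hD₂)

/-- **The drift gradient is jointly measurable.** [folklore] -/
theorem stronglyMeasurable_uncurry_driftGrad (hW : IsGoodVelocity W) :
    StronglyMeasurable (uncurry (driftGrad W)) :=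
  stronglyMeasurable_fderiv_param (stronglyMeasurable_uncurry_driftField hW)
    fun t x => ((contDiff_driftField hW t (n := 1)).differentiable one_ne_zero) x

/-- **Uniform bounds for the drift**: `‖h(t, x)‖ ≤ C ‖W(t)‖_{L¹(B₂)}`. [cite: Kwon2023RolePressure, Remark 2.3 (est.h)] -/
theorem exists_norm_driftField_le :
    ∃ C : ℝ, 0 ≤ C ∧ ∀ (W : ℝ → EuclideanSpace ℝ (Fin 3) → EuclideanSpace ℝ (Fin 3)), IsGoodVelocity W →
      ∀ t x, ‖driftField W t x‖ ≤ C * ∫ y in ball (0 : EuclideanSpace ℝ (Fin 3)) 2, ‖W t y‖ := by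
  obtain ⟨C, hC0, hC⟩ := exists_norm_harmonicPart_le
  exact ⟨C, hC0, fun W hW t x => hC (W t) (hW.integrableOn_slice t) x⟩

/-- **Uniform bounds for the drift gradient**: `‖∇h(t, x)‖ ≤ C ‖W(t)‖_{L¹(B₂)}`. [cite: Kwon2023RolePressure, Remark 2.3 (est.h)] -/
theorem exists_norm_driftGrad_le :
    ∃ C : ℝ, 0 ≤ C ∧ ∀ (W : ℝ → EuclideanSpace ℝ (Fin 3) → EuclideanSpace ℝ (Fin 3)), IsGoodVelocity W →
      ∀ t x, ‖driftGrad W t x‖ ≤ C * ∫ y in ball (0 : EuclideanSpace ℝ (Fin 3)) 2, ‖W t y‖ := by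
  obtain ⟨C, hC0, hC⟩ := exists_norm_fderiv_harmonicPart_le
  exact ⟨C, hC0, fun W hW t x => hC (W t) (hW.integrableOn_slice t) x⟩

end Drift

/-! ### The force `f` -/

section Force

open Literature.Analysis.FunctionSpaces

variable {W : ℝ → EuclideanSpace ℝ (Fin 3) → EuclideanSpace ℝ (Fin 3)}

/-- The convective densities `(t, x) ↦ Wᵢ(t,x) W(t,x)` are jointly measurable. [folklore] -/
theorem stronglyMeasurable_uncurry_coord_smul (hW : StronglyMeasurable (uncurry W)) (i : Fin 3) :
    StronglyMeasurable (uncurry fun t x => W t x i • W t x) :=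
  ((EuclideanSpace.proj i).continuous.comp_stronglyMeasurable hW).smul hW

/-- **Transposed commutators of a measurable family are jointly measurable**:
`(t, y) ↦ T'_K(w(t))(y) = ∫ 𝔠_K(x,y)ᵀ w(t,x) dx`. [folklore] -/
theorem stronglyMeasurable_uncurry_curlKernelTranspose
    {K : EuclideanSpace ℝ (Fin 3) → EuclideanSpace ℝ (Fin 3) →
      EuclideanSpace ℝ (Fin 3) →L[ℝ] EuclideanSpace ℝ (Fin 3)} (hK : ContDiff ℝ 1 (uncurry K))
    {w : ℝ → EuclideanSpace ℝ (Fin 3) → EuclideanSpace ℝ (Fin 3)} (hw : StronglyMeasurable (uncurry w)) :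
    StronglyMeasurable (uncurry fun t y => curlKernelTranspose K (w t) y) := by
  -- the integrand `(t, y, x) ↦ 𝔠_K(x,y)ᵀ w(t,x)`, coordinatewise (composing with the jointly
  -- continuous `uncurry (curlKernel K)` under an applied expected type is too slow to elaborate)
  have hmeas : Measurable fun q : (ℝ × EuclideanSpace ℝ (Fin 3)) × EuclideanSpace ℝ (Fin 3) => (q.2, q.1.2) :=
    measurable_snd.prodMk (measurable_snd.comp measurable_fst)
  have hw' : StronglyMeasurable fun q : (ℝ × EuclideanSpace ℝ (Fin 3)) × EuclideanSpace ℝ (Fin 3) => w q.1.1 q.2 :=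
    hw.comp_measurable ((measurable_fst.comp measurable_fst).prodMk measurable_snd)
  have hint : StronglyMeasurable fun q : (ℝ × EuclideanSpace ℝ (Fin 3)) × EuclideanSpace ℝ (Fin 3) =>
      ∑ j, ⟪w q.1.1 q.2, uncurry (curlKernel K) (q.2, q.1.2) (EuclideanSpace.single j (1 : ℝ))⟫ •
        EuclideanSpace.single (j : Fin 3) (1 : ℝ) := by
    refine Finset.stronglyMeasurable_fun_sum _ fun j _ => ?_
    have hc : Continuous fun p : EuclideanSpace ℝ (Fin 3) × EuclideanSpace ℝ (Fin 3) =>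
        uncurry (curlKernel K) p (EuclideanSpace.single j (1 : ℝ)) :=
      (continuous_curlKernel hK).clm_apply continuous_const
    exact (hw'.inner (hc.stronglyMeasurable.comp_measurable hmeas)).smul_const _
  have h := hint.integral_prod_right' (ν := volume)
  simp only [Function.uncurry_apply_pair] at h
  exact h

/-- **The harmonic-part curl forces of a measurable family are jointly measurable**:
`(t, y) ↦ curl((∂ₐk) ⋆ (∇φ × w(t)))(y)`. [folklore] -/
theorem stronglyMeasurable_uncurry_curl_potentialDeriv (a : EuclideanSpace ℝ (Fin 3))
    {w : ℝ → EuclideanSpace ℝ (Fin 3) → EuclideanSpace ℝ (Fin 3)} (hw : StronglyMeasurable (uncurry w))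
    (hwi : ∀ t, IntegrableOn (w t) (ball (0 : EuclideanSpace ℝ (Fin 3)) 2)) :
    StronglyMeasurable (uncurry fun t y => curl ((fun z => fderiv ℝ annularKernel z a) ⋆[lsmul ℝ ℝ, volume]
      vectorDensity (w t)) y) := by
  set Φ : ℝ → EuclideanSpace ℝ (Fin 3) → EuclideanSpace ℝ (Fin 3) :=
    fun t => (fun z => fderiv ℝ annularKernel z a) ⋆[lsmul ℝ ℝ, volume] vectorDensity (w t) with hΦ
  have e : Φ = fun t x => ∫ s, fderiv ℝ annularKernel s a • vectorDensity (w t) (x - s) := by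
    funext t x; rw [hΦ]; dsimp only; rw [convolution_lsmul]
  have hk : Continuous fun z => fderiv ℝ annularKernel z a :=
    ((contDiff_annularKernel (n := 1)).continuous_fderiv one_ne_zero).clm_apply continuous_const
  have hΦm : StronglyMeasurable (uncurry Φ) := by
    rw [e]; exact stronglyMeasurable_uncurry_convolution_vector hk (stronglyMeasurable_uncurry_vectorDensity hw)
  have hΦd : ∀ t x, DifferentiableAt ℝ (Φ t) x := fun t x =>
    (((hasCompactSupport_annularKernel.fderiv_apply (𝕜 := ℝ) a).contDiff_convolution_left _
      (((contDiff_annularKernel (n := 2)).fderiv_right (m := 1) le_rfl).clm_apply contDiff_const)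
      (integrable_vectorDensity (hwi t)).locallyIntegrable).differentiable one_ne_zero) x
  have hD := stronglyMeasurable_fderiv_param hΦm hΦd
  have e' : uncurry (fun t y => curl (Φ t) y) = fun q : ℝ × EuclideanSpace ℝ (Fin 3) =>
      curlCLM (fderiv ℝ (Φ q.1) q.2) := by funext q; rfl
  show StronglyMeasurable (uncurry fun t y => curl (Φ t) y)
  rw [e']
  exact curlCLM.continuous.comp_stronglyMeasurable hD

/-- The cut-off self-stretching `(t, y) ↦ F(t, y) = φ♭(y) ∇h(t,y) h(t,y)` is jointly measurable. [folklore] -/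
theorem stronglyMeasurable_uncurry_selfStretch (hW : IsGoodVelocity W) :
    StronglyMeasurable (uncurry fun t y => selfStretch (W t) y) := by
  have happ : StronglyMeasurable fun q : ℝ × EuclideanSpace ℝ (Fin 3) =>
      driftGrad W q.1 q.2 (driftField W q.1 q.2) :=
    (isBoundedBilinearMap_apply (𝕜 := ℝ) (E := EuclideanSpace ℝ (Fin 3))
      (F := EuclideanSpace ℝ (Fin 3))).continuous.comp_stronglyMeasurable
      ((stronglyMeasurable_uncurry_driftGrad hW).prodMk (stronglyMeasurable_uncurry_driftField hW))
  have e : uncurry (fun t y => selfStretch (W t) y) = fun q : ℝ × EuclideanSpace ℝ (Fin 3) =>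
      kwonFlatCutoff q.2 • driftGrad W q.1 q.2 (driftField W q.1 q.2) := by
    funext q; rfl
  rw [e]
  exact ((contDiff_kwonFlatCutoff (n := 0)).continuous.comp continuous_snd).stronglyMeasurable.smul happ

/-- **The Leray projection of the self-stretching is jointly measurable**:
`(t, y) ↦ P[F(t)](y) = F(t,y) − ∇π[F(t)](y)`, `π[G](y) = ∫ Γ(y − s) div G(s) ds`. [folklore] -/
theorem stronglyMeasurable_uncurry_classicalLerayProj_selfStretch (hW : IsGoodVelocity W) :
    StronglyMeasurable (uncurry fun t y => classicalLerayProj (selfStretch (W t)) y) := by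
  have hF := stronglyMeasurable_uncurry_selfStretch hW
  have hFs : ∀ t, ContDiff ℝ ∞ (selfStretch (W t)) := fun t => contDiff_selfStretch (hW.integrableOn_slice t)
  have hFc : ∀ t, HasCompactSupport (selfStretch (W t)) := fun t => hasCompactSupport_selfStretch
  -- `div F` is jointly measurable
  have hDF := stronglyMeasurable_fderiv_param hF fun t x =>
    ((hFs t).differentiable (by simp)) x
  have hdiv : StronglyMeasurable fun q : ℝ × EuclideanSpace ℝ (Fin 3) =>
      VectorCalculus.divergence (selfStretch (W q.1)) q.2 := by
    have e : (fun q : ℝ × EuclideanSpace ℝ (Fin 3) => VectorCalculus.divergence (selfStretch (W q.1)) q.2) =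
        fun q => traceCLM (fderiv ℝ (selfStretch (W q.1)) q.2) := by
      funext q; rw [divergence_eq_traceCLM]
    rw [e]; exact traceCLM.continuous.comp_stronglyMeasurable hDF
  -- the divergence potential as a parametric integral
  have hπ : StronglyMeasurable (uncurry fun t y => divPotential (selfStretch (W t)) y) := by
    have e : uncurry (fun t y => divPotential (selfStretch (W t)) y) = fun q : ℝ × EuclideanSpace ℝ (Fin 3) =>
        ∫ s, newtonKernel (q.2 - s) * VectorCalculus.divergence (selfStretch (W q.1)) s := by
      funext q; exact divPotential_apply _ _
    rw [e]
    have h : StronglyMeasurable fun r : (ℝ × EuclideanSpace ℝ (Fin 3)) × EuclideanSpace ℝ (Fin 3) =>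
        newtonKernel (r.1.2 - r.2) * VectorCalculus.divergence (selfStretch (W r.1.1)) r.2 :=
      (measurable_newtonKernel.comp ((measurable_snd.comp measurable_fst).sub measurable_snd)).stronglyMeasurable.mul
        (hdiv.comp_measurable ((measurable_fst.comp measurable_fst).prodMk measurable_snd))
    exact h.integral_prod_right'
  have hπd : ∀ t y, DifferentiableAt ℝ (divPotential (selfStretch (W t))) y := fun t y =>
    ((contDiff_divPotential (hFs t) (hFc t)).differentiable (by simp)) y
  have hDπ := stronglyMeasurable_fderiv_param hπ hπd
  have e : uncurry (fun t y => classicalLerayProj (selfStretch (W t)) y) = fun q : ℝ × EuclideanSpace ℝ (Fin 3) =>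
      selfStretch (W q.1) q.2 - (InnerProductSpace.toDual ℝ (EuclideanSpace ℝ (Fin 3))).symm
        (fderiv ℝ (divPotential (selfStretch (W q.1))) q.2) := by
    funext q; rfl
  rw [e]
  exact hF.sub ((InnerProductSpace.toDual ℝ (EuclideanSpace ℝ (Fin 3))).symm.continuous.comp_stronglyMeasurable hDπ)

variable (W) in
/-- **Kwon's force** `f(t, ·) = f_{W(t)}` (`kwonSliceForce` of the slices). [cite: Kwon2023RolePressure, Lemma 2.5] -/
def forceField (t : ℝ) (y : EuclideanSpace ℝ (Fin 3)) : EuclideanSpace ℝ (Fin 3) := kwonSliceForce (W t) y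

/-- **The force is jointly measurable.** [folklore] -/
theorem stronglyMeasurable_uncurry_forceField (hW : IsGoodVelocity W) :
    StronglyMeasurable (uncurry (forceField W)) := by
  have hWm := hW.stronglyMeasurable
  have h1 := stronglyMeasurable_uncurry_curlKernelTranspose (contDiff_uncurry_commKernelLap (n := 1)) hWm
  have h2 : ∀ i : Fin 3, StronglyMeasurable (uncurry fun t y => curlKernelTranspose
      (commKernelDir (EuclideanSpace.single i (1 : ℝ))) (fun x => W t x i • W t x) y) := fun i =>
    stronglyMeasurable_uncurry_curlKernelTranspose (contDiff_uncurry_commKernelDir _ (n := 1))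
      (stronglyMeasurable_uncurry_coord_smul hWm i)
  have h3 : ∀ i : Fin 3, StronglyMeasurable (uncurry fun t y => curl ((fun z => fderiv ℝ annularKernel z
      (EuclideanSpace.single i (1 : ℝ))) ⋆[lsmul ℝ ℝ, volume] vectorDensity (fun x => W t x i • W t x)) y) :=
    fun i => stronglyMeasurable_uncurry_curl_potentialDeriv _ (stronglyMeasurable_uncurry_coord_smul hWm i)
      fun t => (integrable_coord_smul (hW.aestronglyMeasurable_slice t) (hW.integrable_sq t) i).integrableOn
  have h4 := stronglyMeasurable_uncurry_classicalLerayProj_selfStretch hW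
  have e : uncurry (forceField W) = fun q : ℝ × EuclideanSpace ℝ (Fin 3) =>
      -(uncurry (fun t y => curlKernelTranspose commKernelLap (W t) y) q)
      - ∑ i, uncurry (fun t y => curlKernelTranspose (commKernelDir (EuclideanSpace.single i (1 : ℝ)))
          (fun x => W t x i • W t x) y) q
      - ∑ i, uncurry (fun t y => curl ((fun z => fderiv ℝ annularKernel z (EuclideanSpace.single i (1 : ℝ)))
          ⋆[lsmul ℝ ℝ, volume] vectorDensity (fun x => W t x i • W t x)) y) q
      - uncurry (fun t y => classicalLerayProj (selfStretch (W t)) y) q := by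
    funext q; rfl
  rw [e]
  exact ((h1.neg.sub (Finset.stronglyMeasurable_fun_sum _ fun i _ => h2 i)).sub
    (Finset.stronglyMeasurable_fun_sum _ fun i _ => h3 i)).sub h4

end Force

/-! ### The pressure `q` -/

section Pressure

open Literature.Analysis.FunctionSpaces

variable {W : ℝ → EuclideanSpace ℝ (Fin 3) → EuclideanSpace ℝ (Fin 3)} {P : ℝ → EuclideanSpace ℝ (Fin 3) → ℝ}

variable (W P) in
/-- **Kwon's pressure** `q(t, ·)`: the slice pressure `kwonSlicePressure (W t)` with its
Calderón–Zygmund piece `Π[√φ W(t)] − Λ[Π[√φ W(t)]]` written through a jointly measurable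
space–time representative `P` of the Riesz pressures of the weighted slices (`P(t) = Π[√φ W(t)]`
a.e., for a.e. `t`). [cite: Kwon2023RolePressure, Lemma 2.5] -/
def pressureField (t : ℝ) (y : EuclideanSpace ℝ (Fin 3)) : ℝ :=
  (P t y - newtonFarSmoothing 3 4 (P t) y)
    - shellPressure (fun x => scalarDensity (W t) x • W t x) y
    - ∑ i, ((fun z => fderiv ℝ annularKernel z (EuclideanSpace.single (i : Fin 3) (1 : ℝ))) ⋆
        scalarDensity (fun x => W t x i • W t x)) y
    + divPotential (selfStretch (W t)) y

/-- `Λ` does not see null sets: `Λ[g] = Λ[g']` everywhere if `g = g'` a.e. [folklore] -/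
theorem newtonFarSmoothing_congr_ae {g g' : EuclideanSpace ℝ (Fin 3) → ℝ} (h : g =ᵐ[volume] g')
    (y : EuclideanSpace ℝ (Fin 3)) : newtonFarSmoothing 3 4 g y = newtonFarSmoothing 3 4 g' y := by
  rw [newtonFarSmoothing_apply, newtonFarSmoothing_apply]
  refine integral_congr_ae ?_
  have hq : Measure.QuasiMeasurePreserving (fun z : EuclideanSpace ℝ (Fin 3) => y - z) volume volume :=
    (Measure.measurePreserving_sub_left volume y).quasiMeasurePreserving
  filter_upwards [hq.ae_eq_comp h] with z hz
  simp only [Function.comp_apply] at hz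
  rw [hz]

/-- **At a good time the pressure field is the slice pressure, a.e. in space.** [folklore] -/
theorem pressureField_ae_eq {t : ℝ} (hP : P t =ᵐ[volume] rieszPressure (sqrtCutoffSMul (W t))) :
    pressureField W P t =ᵐ[volume] kwonSlicePressure (W t) := by
  filter_upwards [hP] with y hy
  rw [pressureField, kwonSlicePressure, czPressure, hy, newtonFarSmoothing_congr_ae hP y]

/-- `(t, y) ↦ Λ[P(t)](y)` is jointly measurable. [folklore] -/
theorem stronglyMeasurable_uncurry_newtonFarSmoothing (hPm : StronglyMeasurable (uncurry P)) :
    StronglyMeasurable (uncurry fun t y => newtonFarSmoothing 3 4 (P t) y) := by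
  have e : (uncurry fun t y => newtonFarSmoothing 3 4 (P t) y) =
      uncurry fun t y => ∫ s, newtonFarLaplacian 3 4 s * P t (y - s) := by
    funext q; simp only [uncurry, newtonFarSmoothing_apply]
  rw [e]
  exact stronglyMeasurable_uncurry_convolution_scalar (continuous_newtonFarLaplacian (by norm_num) (by norm_num)) hPm

/-- `(t, y) ↦ P_{(W·∇φ)W(t)}(y)` (the shell pressure) is jointly measurable. [folklore] -/
theorem stronglyMeasurable_uncurry_shellPressure (hW : StronglyMeasurable (uncurry W)) :
    StronglyMeasurable (uncurry fun t y => shellPressure (fun x => scalarDensity (W t) x • W t x) y) := by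
  have hg : StronglyMeasurable (uncurry fun t x => scalarDensity (W t) x • W t x) :=
    (stronglyMeasurable_uncurry_scalarDensity hW).smul hW
  have hk : Continuous (gradient annularKernel) :=
    FluidPDE.continuous_gradient_of_contDiff (contDiff_annularKernel (n := 1))
  have h : StronglyMeasurable fun r : (ℝ × EuclideanSpace ℝ (Fin 3)) × EuclideanSpace ℝ (Fin 3) =>
      ⟪uncurry (fun t x => scalarDensity (W t) x • W t x) (r.1.1, r.2), gradient annularKernel (r.2 - r.1.2)⟫ :=
    (hg.comp_measurable ((measurable_fst.comp measurable_fst).prodMk measurable_snd)).inner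
      (hk.comp (continuous_snd.sub (continuous_snd.comp continuous_fst))).stronglyMeasurable
  have h' := h.integral_prod_right' (ν := volume)
  simp only [Function.uncurry_apply_pair] at h'
  exact h'

/-- `(t, y) ↦ ((∂ₐk) ⋆ ((WᵢW)(t)·∇φ))(y)` is jointly measurable. [folklore] -/
theorem stronglyMeasurable_uncurry_potentialDeriv_scalar (hW : StronglyMeasurable (uncurry W))
    (a : EuclideanSpace ℝ (Fin 3)) (i : Fin 3) :
    StronglyMeasurable (uncurry fun t y => ((fun z => fderiv ℝ annularKernel z a) ⋆
      scalarDensity (fun x => W t x i • W t x)) y) := by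
  have e : (uncurry fun t y => ((fun z => fderiv ℝ annularKernel z a) ⋆
      scalarDensity (fun x => W t x i • W t x)) y) =
      uncurry fun t y => ∫ s, fderiv ℝ annularKernel s a * scalarDensity (fun x => W t x i • W t x) (y - s) := by
    funext q; simp only [uncurry]; rw [convolution_lsmul]; rfl
  rw [e]
  exact stronglyMeasurable_uncurry_convolution_scalar
    (((contDiff_annularKernel (n := 1)).continuous_fderiv one_ne_zero).clm_apply continuous_const)
    (stronglyMeasurable_uncurry_scalarDensity (stronglyMeasurable_uncurry_coord_smul hW i))

/-- `(t, y) ↦ π[F(t)](y)` (the divergence potential of the self-stretching) is jointly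
measurable. [folklore] -/
theorem stronglyMeasurable_uncurry_divPotential_selfStretch (hW : IsGoodVelocity W) :
    StronglyMeasurable (uncurry fun t y => divPotential (selfStretch (W t)) y) := by
  have hF := stronglyMeasurable_uncurry_selfStretch hW
  have hFs : ∀ t, ContDiff ℝ ∞ (selfStretch (W t)) := fun t => contDiff_selfStretch (hW.integrableOn_slice t)
  have hDF := stronglyMeasurable_fderiv_param hF fun t x => ((hFs t).differentiable (by simp)) x
  have hdiv : StronglyMeasurable fun q : ℝ × EuclideanSpace ℝ (Fin 3) =>
      VectorCalculus.divergence (selfStretch (W q.1)) q.2 := by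
    have e : (fun q : ℝ × EuclideanSpace ℝ (Fin 3) => VectorCalculus.divergence (selfStretch (W q.1)) q.2) =
        fun q => traceCLM (fderiv ℝ (selfStretch (W q.1)) q.2) := by
      funext q; rw [divergence_eq_traceCLM]
    rw [e]; exact traceCLM.continuous.comp_stronglyMeasurable hDF
  have e : uncurry (fun t y => divPotential (selfStretch (W t)) y) = fun q : ℝ × EuclideanSpace ℝ (Fin 3) =>
      ∫ s, newtonKernel (q.2 - s) * VectorCalculus.divergence (selfStretch (W q.1)) s := by
    funext q; exact divPotential_apply _ _
  rw [e]
  have h : StronglyMeasurable fun r : (ℝ × EuclideanSpace ℝ (Fin 3)) × EuclideanSpace ℝ (Fin 3) =>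
      newtonKernel (r.1.2 - r.2) * VectorCalculus.divergence (selfStretch (W r.1.1)) r.2 :=
    (measurable_newtonKernel.comp ((measurable_snd.comp measurable_fst).sub measurable_snd)).stronglyMeasurable.mul
      (hdiv.comp_measurable ((measurable_fst.comp measurable_fst).prodMk measurable_snd))
  exact h.integral_prod_right'

/-- **The pressure is jointly measurable** (given a jointly measurable Riesz representative). [folklore] -/
theorem stronglyMeasurable_uncurry_pressureField (hW : IsGoodVelocity W) (hPm : StronglyMeasurable (uncurry P)) :
    StronglyMeasurable (uncurry (pressureField W P)) := by
  have h1 := stronglyMeasurable_uncurry_newtonFarSmoothing hPm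
  have h2 := stronglyMeasurable_uncurry_shellPressure hW.stronglyMeasurable
  have h3 : ∀ i : Fin 3, StronglyMeasurable (uncurry fun t y => ((fun z => fderiv ℝ annularKernel z
      (EuclideanSpace.single i (1 : ℝ))) ⋆ scalarDensity (fun x => W t x i • W t x)) y) := fun i =>
    stronglyMeasurable_uncurry_potentialDeriv_scalar hW.stronglyMeasurable _ i
  have h4 := stronglyMeasurable_uncurry_divPotential_selfStretch hW
  have e : uncurry (pressureField W P) = fun q : ℝ × EuclideanSpace ℝ (Fin 3) =>
      (uncurry P q - uncurry (fun t y => newtonFarSmoothing 3 4 (P t) y) q)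
      - uncurry (fun t y => shellPressure (fun x => scalarDensity (W t) x • W t x) y) q
      - ∑ i, uncurry (fun t y => ((fun z => fderiv ℝ annularKernel z (EuclideanSpace.single i (1 : ℝ))) ⋆
          scalarDensity (fun x => W t x i • W t x)) y) q
      + uncurry (fun t y => divPotential (selfStretch (W t)) y) q := by
    funext q; rfl
  rw [e]
  exact (((hPm.sub h1).sub h2).sub (Finset.stronglyMeasurable_fun_sum _ fun i _ => h3 i)).add h4

end Pressure

/-! ### A jointly measurable representative of the Riesz pressures of the weighted slices -/

section RieszRepresentative

variable {W : ℝ → EuclideanSpace ℝ (Fin 3) → EuclideanSpace ℝ (Fin 3)}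

/-- Transport of an a.e. statement on `(0, 4)` to `(−4, 0)` along `t ↦ t + 4`. [folklore] -/
theorem ae_restrict_Ioo_neg_four_of_ae_restrict_Ioo {Q : ℝ → Prop}
    (h : ∀ᵐ s ∂(volume.restrict (Ioo (0 : ℝ) 4)), Q s) :
    ∀ᵐ t ∂(volume.restrict (Ioo (-4 : ℝ) 0)), Q (t + 4) := by
  have hmp : MeasurePreserving (fun t : ℝ => t + 4) (volume.restrict (Ioo (-4 : ℝ) 0))
      (volume.restrict (Ioo (0 : ℝ) 4)) := by
    have h0 := (measurePreserving_add_right (volume : Measure ℝ) (4 : ℝ)).restrict_preimage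
      (measurableSet_Ioo (a := (0 : ℝ)) (b := 4))
    have hpre : (fun t : ℝ => t + 4) ⁻¹' Ioo (0 : ℝ) 4 = Ioo (-4 : ℝ) 0 := by
      ext t; simp only [mem_preimage, mem_Ioo]; constructor <;> intro ht <;> constructor <;> linarith [ht.1, ht.2]
    rwa [hpre] at h0
  exact hmp.quasiMeasurePreserving.ae h

/-- **The Riesz pressures of the weighted slices `√φ W(t)` admit a jointly measurable space–time
representative** on `(−4, 0) × ℝ³`, in `L^{3/2}`, with Stein's slice bound
(the tree's `exists_spaceTime_rieszPressure_of_memLp` on `(0, 4)`, shifted in time).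
[cite: Kwon2023RolePressure, Lemma 2.5 (est.q)] -/
theorem exists_rieszRepresentative (hW : IsGoodVelocity W) :
    ∃ P : ℝ → EuclideanSpace ℝ (Fin 3) → ℝ, StronglyMeasurable (uncurry P) ∧
      MemLp (uncurry P) (3 / 2 : ℝ≥0∞) (volume.restrict (Ioo (-4 : ℝ) 0 ×ˢ (univ : Set (EuclideanSpace ℝ (Fin 3))))) ∧
      ∀ᵐ t ∂(volume.restrict (Ioo (-4 : ℝ) 0)),
        P t =ᵐ[volume] rieszPressure (sqrtCutoffSMul (W t)) ∧
        MemLp (P t) (3 / 2 : ℝ≥0∞) volume ∧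
        eLpNorm (P t) (3 / 2 : ℝ≥0∞) volume ≤ steinConstThreeHalves * eLpNorm (W t) 3 volume ^ 2 := by
  -- the shifted weighted field on `(0, 4)`
  set u' : ℝ → EuclideanSpace ℝ (Fin 3) → EuclideanSpace ℝ (Fin 3) :=
    fun s x => sqrtCutoffSMul (W (s - 4)) x with hu'
  have hshift : MeasurePreserving (fun z : ℝ × EuclideanSpace ℝ (Fin 3) => (z.1 - 4, z.2))
      (volume : Measure (ℝ × EuclideanSpace ℝ (Fin 3))) volume := by
    rw [Measure.volume_eq_prod]
    exact (measurePreserving_sub_right volume (4 : ℝ)).prod (MeasurePreserving.id volume)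
  have hWsm : StronglyMeasurable (uncurry fun s x => W (s - 4) x) :=
    hW.stronglyMeasurable.comp_measurable hshift.measurable
  have hu'm : StronglyMeasurable (uncurry u') :=
    ((Real.continuous_sqrt.comp ((contDiff_kwonCutoff (n := 0)).continuous)).comp
      continuous_snd).stronglyMeasurable.smul hWsm
  have hu'3 : MemLp (uncurry u') 3 volume := by
    have hW3 : MemLp (uncurry W) 3 volume := by
      refine ⟨hW.stronglyMeasurable.aestronglyMeasurable, ?_⟩
      rw [eLpNorm_lt_top_iff_lintegral_rpow_enorm_lt_top (by norm_num) (by norm_num)]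
      simpa [ENNReal.toReal_ofNat] using hW.lintegral_cube_lt_top
    have hW3' : MemLp (uncurry fun s x => W (s - 4) x) 3 volume := hW3.comp_measurePreserving hshift
    refine hW3'.of_le hu'm.aestronglyMeasurable (Eventually.of_forall fun z => ?_)
    exact norm_sqrtCutoffSMul_le (U := W (z.1 - 4)) z.2
  obtain ⟨p, hpm, hpmem, hp⟩ := exists_spaceTime_rieszPressure_of_memLp (u := u') (by norm_num : (0 : ℝ) < 4)
    (hu'3.restrict _)
  -- a strongly measurable version of `p` on the slab, and its time shift
  set μ' : Measure (ℝ × EuclideanSpace ℝ (Fin 3)) := volume.restrict (Ioo (0 : ℝ) 4 ×ˢ (univ : Set (EuclideanSpace ℝ (Fin 3)))) with hμ'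
  set P₀ : ℝ × EuclideanSpace ℝ (Fin 3) → ℝ := hpm.mk (uncurry p) with hP₀
  have hP₀m : StronglyMeasurable P₀ := hpm.stronglyMeasurable_mk
  have hP₀eq : uncurry p =ᵐ[μ'] P₀ := hpm.ae_eq_mk
  have hμ'prod : μ' = (volume.restrict (Ioo (0 : ℝ) 4)).prod (volume : Measure (EuclideanSpace ℝ (Fin 3))) := by
    rw [hμ', Measure.volume_eq_prod, Measure.restrict_prod_eq_prod_univ]
  have hslice : ∀ᵐ s ∂(volume.restrict (Ioo (0 : ℝ) 4)), (fun x => P₀ (s, x)) =ᵐ[volume] p s := by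
    have h' : ∀ᵐ z ∂((volume.restrict (Ioo (0 : ℝ) 4)).prod (volume : Measure (EuclideanSpace ℝ (Fin 3)))),
        uncurry p z = P₀ z := by rw [← hμ'prod]; exact hP₀eq
    filter_upwards [Measure.ae_ae_of_ae_prod h'] with s hs
    filter_upwards [hs] with x hx
    exact hx.symm
  set P : ℝ → EuclideanSpace ℝ (Fin 3) → ℝ := fun t x => P₀ (t + 4, x) with hPdef
  refine ⟨P, ?_, ?_, ?_⟩
  · exact hP₀m.comp_measurable ((measurable_fst.add_const _).prodMk measurable_snd)
  · -- `L^{3/2}` on the shifted slab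
    have hshift' : MeasurePreserving (fun z : ℝ × EuclideanSpace ℝ (Fin 3) => (z.1 + 4, z.2))
        (volume.restrict (Ioo (-4 : ℝ) 0 ×ˢ (univ : Set (EuclideanSpace ℝ (Fin 3))))) μ' := by
      have h0 : MeasurePreserving (fun z : ℝ × EuclideanSpace ℝ (Fin 3) => (z.1 + 4, z.2))
          (volume : Measure (ℝ × EuclideanSpace ℝ (Fin 3))) volume := by
        rw [Measure.volume_eq_prod]
        exact (measurePreserving_add_right volume (4 : ℝ)).prod (MeasurePreserving.id volume)
      have h1 := h0.restrict_preimage ((measurableSet_Ioo (a := (0 : ℝ)) (b := 4)).prod MeasurableSet.univ)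
      have hpre : (fun z : ℝ × EuclideanSpace ℝ (Fin 3) => (z.1 + 4, z.2)) ⁻¹'
          (Ioo (0 : ℝ) 4 ×ˢ (univ : Set (EuclideanSpace ℝ (Fin 3)))) = Ioo (-4 : ℝ) 0 ×ˢ univ := by
        ext z; simp only [mem_preimage, mem_prod, mem_Ioo, mem_univ, and_true]
        constructor <;> intro hz <;> constructor <;> linarith [hz.1, hz.2]
      rwa [hpre] at h1
    have hP₀mem : MemLp P₀ (3 / 2 : ℝ≥0∞) μ' := hpmem.ae_eq hP₀eq
    exact hP₀mem.comp_measurePreserving hshift'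
  · have hp' := ae_restrict_Ioo_neg_four_of_ae_restrict_Ioo
      (Q := fun s => ((fun x => P₀ (s, x)) =ᵐ[volume] p s) ∧ (p s =ᵐ[volume] rieszPressure (u' s) ∧
        MemLp (u' s) 3 volume ∧ MemLp (p s) (3 / 2 : ℝ≥0∞) volume ∧
        eLpNorm (p s) (3 / 2 : ℝ≥0∞) volume ≤ steinConstThreeHalves * eLpNorm (u' s) 3 volume ^ 2 ∧
        ∀ φ : EuclideanSpace ℝ (Fin 3) → ℝ, ContDiff ℝ (⊤ : ℕ∞) φ → HasCompactSupport φ →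
          ∫ x, p s x * (Δ φ) x = -∫ x, fderiv ℝ (fderiv ℝ φ) x (u' s x) (u' s x)))
      (hslice.and hp)
    filter_upwards [hp'] with t ht
    obtain ⟨h1, h2, -, h4, h5, -⟩ := ht
    have e : u' (t + 4) = sqrtCutoffSMul (W t) := by
      funext x; simp only [hu', add_sub_cancel_right]
    have hPt : P t =ᵐ[volume] p (t + 4) := h1
    refine ⟨hPt.trans (e ▸ h2), h4.ae_eq hPt.symm, ?_⟩
    rw [eLpNorm_congr_ae hPt]
    refine h5.trans ?_
    rw [e]
    gcongr
    exact eLpNorm_sqrtCutoffSMul_le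

end RieszRepresentative

end Kwon2023

end Literature.Analysis.FluidPDE

end
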